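import Summits.ValiantsHypothesis.ValiantsHypothesis.Theses.NumTame
import Literature.Computability.AlgebraicComplexity.ArithCircuitProofs

/-!
# Route NumTame — item 5392 `Assembly`

Item `stmt-ValiantsHypothesis-5392` (assembly, rank 1):
`TameNF → TameA3 → CoeffBoundA2 → BoolHyp → ValiantsHypothesis`.

**Proof** (Bürgisser 2000 TCS, proof of Cor. 1.2(1), p. 79, re-run over the route's GRH-free tame
typings; compare the tree's `Literature.Computability.AlgebraicComplexity.NP_subset_PPoly_of_VP_eq_VNP`,
which does the same over the named facts (A2)/(A3)+GRH). Suppose `VP ℂ = VNP ℂ` and let `L ∈ NP`.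
`CoeffBoundA2` gives a p-definable family `f` with Boolean part `φ` (bit size `t`) deciding `L` by
positivity, with degrees and coefficient moduli bounded by `r n` resp. `2^(r n)`, `r` p-bounded;
`isVPFamily_of_VP_eq_VNP` makes `f` p-computable and `exists_computes_size_eq_complexity` yields
fan-in-two circuits of size `complexity (f n)`; `TameNF` (at `t := r n`) replaces them by cube-tame
circuits computing `f n` EXACTLY, with size and all magnitudes bounded by `2^(r' n)`,
`r' n := (complexity (f n) + n + r n + deg f_n)^c + c` — p-bounded by the closure lemmas
`IsPBounded.add_holds` / `IsPBounded.pow_holds`; exact computation gives agreement with `φ` on the cube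
(`IsBooleanPart.eval_eq`), so `TameA3` yields polynomial-size `B₂`-circuits for the bits of `φ`, and
`positivity_mem_PPoly` puts `L` in `P/poly` — contradicting `BoolHyp : ¬ (NP ⊆ P/poly)`.

Honest framing: pure glue on a dormant route whose cruxes `TameNF` (cube-tame normal form) and
`BoolHyp` (NP ⊄ P/poly) remain OPEN; nothing here bears on VP ≠ VNP itself (NOT proved).
-/

-- layout Summits/ValiantsHypothesis/ValiantsHypothesis forces the duplicated namespace component
set_option linter.dupNamespace false

namespace Summit.ValiantsHypothesis.ValiantsHypothesis.Theorems.NumTame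

open MvPolynomial Literature.Computability.AlgebraicComplexity Literature.Computability.Complexity

/-- The p-bounded magnitude exponent of the assembly: `(s n + n + r n + d n)^c + c` is p-bounded when
`s`, `r`, `d` are. -/
theorem isPBounded_tameBound {s r d : ℕ → ℕ} (hs : IsPBounded s) (hr : IsPBounded r)
    (hd : IsPBounded d) (c : ℕ) : IsPBounded fun n => (s n + n + r n + d n) ^ c + c := by
  have h1 : IsPBounded fun n => s n + n + r n + d n :=
    IsPBounded.add_holds (IsPBounded.add_holds (IsPBounded.add_holds hs IsPBounded.id) hr) hd
  exact IsPBounded.add_holds (IsPBounded.pow_holds h1 c) (IsPBounded.const c)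

/-- **`NP ⊆ P/poly` from `VP ℂ = VNP ℂ` over the tame typings** (the contrapositive core of the
assembly): `TameNF`, `TameA3` and `CoeffBoundA2` replace Bürgisser's (A3)+GRH. -/
theorem NP_subset_PPoly_of_tame (hNF : Theses.NumTame.TameNF) (hA3 : Theses.NumTame.TameA3)
    (hA2 : Theses.NumTame.CoeffBoundA2) (h : VP ℂ = VNP ℂ) : Nondeterministic.NP ⊆ PPoly := by
  intro L hL
  obtain ⟨f, φ, t, hf, hφ, hLφ, r, hr, hbd⟩ := hA2 L hL
  obtain ⟨c, hc⟩ := hNF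
  have hVP : IsVPFamily f := isVPFamily_of_VP_eq_VNP h hf
  -- the magnitude / size exponent of the tame circuits
  set r' : ℕ → ℕ := fun n => (complexity (f n) + n + r n + (f n).totalDegree) ^ c + c with hr'
  have hr'pb : IsPBounded r' := isPBounded_tameBound hVP.2 hr hVP.1.2 c
  -- TameA3 applied to the tame circuits produced by TameNF
  obtain ⟨q, hq⟩ := hA3 φ t hφ.isPBounded hφ.lt ⟨r', hr'pb, fun n => by
    obtain ⟨P, hP2, hPc, hPs⟩ := ArithCircuit.exists_computes_size_eq_complexity (f n)
    obtain ⟨P', hP'c, hP's, hP'2, hP'k, hP'w, hP'o, hP'v⟩ :=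
      hc n (r n) (f n) (hbd n).2 P hP2 hPc
    rw [hPs] at hP's hP'k hP'w hP'o hP'v
    refine ⟨P', hP's, hP'2, hP'k, hP'w, hP'o, hP'v, fun x => ?_⟩
    rw [hP'c]
    exact hφ.eval_eq n x⟩
  -- a disjunction of the output bits decides `L`
  have hmem := positivity_mem_PPoly hφ.isPBounded hφ.lt hq
  have hEq : L = {w : List Bool | 0 < φ w.length w.get} := by
    ext w
    have := hLφ w.length w.get
    rw [List.ofFn_get] at this
    exact this
  rw [hEq]
  exact hmem

/-- **Item 5392 `Assembly`** (the route decl, by name). -/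
theorem assembly_proof : Theses.NumTame.Assembly := by
  intro hNF hA3 hA2 hBool
  change VP ℂ ≠ VNP ℂ
  intro h
  exact hBool (NP_subset_PPoly_of_tame hNF hA3 hA2 h)

end Summit.ValiantsHypothesis.ValiantsHypothesis.Theorems.NumTame
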